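import Literature.Probability.RandomPlanarGeometry.SLEEightThirdsRestrictionLaw
import Literature.Probability.RandomPlanarGeometry.RestrictionHullsHolds
import Literature.Probability.RandomPlanarGeometry.SLEBubblesCloudHolds
import Literature.Probability.RandomPlanarGeometry.SLEBubblesVersionHolds
import Literature.Probability.RandomPlanarGeometry.RestrictionMeasuresFiveEighthsProofs
import HarnessLib

/-!
# `P_{5/8}` exists (unconditionally), and [LSW] p. 5 result 1 from its five remaining leaves

Proof-only sibling of `RestrictionMeasures` / `RestrictionMeasuresExistence` (no definition, no
named fact; everything below is PROVED), for the named fact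
`Literature.Probability.RandomPlanarGeometry.exists_isRestrictionMeasure_iff`, after

* G. F. Lawler, O. Schramm, W. Werner, *Conformal restriction: the chordal case*, J. Amer. Math.
  Soc. **16** (2003) 917–955, arXiv:math/0209343 (**[LSW]**, arXiv page numbers), p. 5 result 1:
  "The restriction measure `P_α` exists if and only if `α ≥ 5/8`" (for `α > 0`, p. 4), proved in
  the paper from Thm. 6.1 (p. 23: "Let `γ` be the SLE_{8/3} path starting at the origin and
  `A ∈ 𝒬*`, then `P[γ[0,∞) ∩ A = ∅] = Φ_A'(0)^{5/8}`. In other words, the law of `γ[0, ∞)` is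
  `P_{5/8}`"), Thm. 7.3 (p. 29, `α > 5/8`: SLE_κ plus a Poisson cloud of Brownian bubbles) and
  Cor. 8.6 (p. 37, no `P_α` for `α < 5/8`);
* S. Rohde, O. Schramm, *Basic properties of SLE*, Ann. of Math. **161** (2005) 883–924, Thm. 5.1
  (SLE_κ is generated by a curve, `κ ≠ 8`).

State of the tree. The two inputs of the `α = 5/8` case are now THEOREMS: SLE_{8/3} is generated
by a curve (`hasSLETrace_eightThirds`, `RestrictionHullsHolds`, from the discharged Rohde–Schramm
estimate) and [LSW] Thm. 6.1 (`sle_restriction_eightThirds_holds`, ibid., from Prop. 5.2/5.3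
`sle_exists_isRestrictionMartingale_of_trace_facts` and Lemmas 6.2/6.3). Hence, through the
session-1 assembly `SLEEightThirdsRestrictionLaw` (the `Ω`-valued version of `γ(0, ∞)` and the
null-set bookkeeping `γ[0, ∞) = γ(0, ∞) ∪ {0}`, `0 ∉ A`):

* `Literature.Probability.RandomPlanarGeometry.exists_sleTrace_eightThirds_version_isRestrictionMeasure` —
  **[LSW] Thm. 6.1, second sentence, unconditionally**: the law of (a measurable `Ω`-valued
  version of) the SLE_{8/3} curve `γ(0, ∞)` is a two-sided restriction measure of exponent `5/8`;
* `Literature.Probability.RandomPlanarGeometry.exists_isRestrictionMeasure_five_eighths` —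
  **`P_{5/8}` exists** (the case `α = 5/8` of the "if" half of p. 5 result 1), and
  `Literature.Probability.RandomPlanarGeometry.existsUnique_isRestrictionMeasure_five_eighths` —
  there is exactly one `P_{5/8}` (with Prop. 3.3's uniqueness, `IsRestrictionMeasure.unique'`);
* `Literature.Probability.RandomPlanarGeometry.IsRestrictionMeasure.exists_eq_map_sleTrace_eightThirds`,
  `Literature.Probability.RandomPlanarGeometry.IsRestrictionMeasure.measure_eq_one_of_isSimplePath_subset'` —
  **every `P_{5/8}` is the law of the SLE_{8/3} curve and is carried by simple curves**
  (p. 5 result 2, the `P_{5/8}` half), unconditionally.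

For general `α` the target is Cor. 8.6 plus existence above `5/8`; with `α = 5/8` settled it is
now EQUIVALENT to "Cor. 8.6 and, for every `α > 5/8`, some `P_α` exists"
(`exists_isRestrictionMeasure_iff_iff_gt`), and it follows from the five named facts that remain
open upstream (`exists_isRestrictionMeasure_iff_of_five_leaves`): on the §8 side the one-sided
restriction martingale of Lemmas 8.9–8.10 (`SLEKappaRho.exists_isOneSidedMartingale`) and the
comparison sentence of p. 38 (`SLEKappaRho.measure_I_notMem_fill_lt_of_neg`), which give Cor. 8.6
(`not_exists_isRestrictionMeasure_of_lt_five_eighths_of_two_leaves`, `RestrictionMeasuresFiveEighthsProofs`);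
on the §7 side the Brownian bubble measure of §7.1 (`exists_isBrownianBubbleMeasure`), `Ξ(κ) ∈ Ω`
almost surely (`SLEBubbles.ae_mem_restrictionConfigs`, end of the proof of Thm. 7.3) and Theorem
6.5 (`SLEBubbles.lintegral_poissonAvoidance_eq_rpow`), which give both halves of Thm. 7.3
(`SLEBubbles.exists_measurable_version_of_ae_mem`, `SLEBubbles.measure_disjoint_of_thm65`,
`SLEBubblesVersionHolds`) and hence `P_α` for all `α ≥ 5/8`
(`exists_isRestrictionMeasure_of_five_eighths_le_of_three_leaves`, Kingman's theorem being
`SLEBubbles.exists_cloud_holds`). The primed variant `exists_isRestrictionMeasure_iff_of_five_leaves'`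
takes the bubble measure with interior points (`exists_isBrownianBubbleMeasure_ae_interior_nonempty`)
instead, i.e. exactly the five leaves of `LawlerSchrammWerner2003_of_five_leaves`
(`ConformalRestrictionFiveLeaves`), so that p. 5 results 1 and 2 close from the same five
`_holds` theorems once they exist:
`exists_isRestrictionMeasure_iff_holds := exists_isRestrictionMeasure_iff_of_five_leaves hM_holds
hlt_holds hμ_holds hcfg_holds h65_holds`.

Mathlib: none beyond the imports. Tree: the assemblies and discharges quoted above.

## References

* [LSW] p. 5 result 1; Prop. 3.3 (pp. 10–11), Thm. 6.1 (p. 23), Thm. 6.5, Thm. 7.3 (p. 29),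
  Thm. 8.4 and Cor. 8.6 (pp. 37–38). [LawlerSchrammWerner2003Restriction]
* S. Rohde, O. Schramm, *Basic properties of SLE*, Ann. of Math. 161 (2005), Thm. 5.1, Thm. 6.1,
  Thm. 7.1. [RohdeSchramm2005]
-/

noncomputable section

open Set MeasureTheory
open scoped NNReal ENNReal
open Literature.Probability.Process (preWienerMeasure)

namespace Literature.Probability.RandomPlanarGeometry

/-! ### [LSW] Thm. 6.1, second sentence: the law of the SLE_{8/3} curve is `P_{5/8}` -/

/-- **[LSW] Thm. 6.1, second sentence ("In other words, the law of `γ[0, ∞)` is `P_{5/8}`"),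
unconditionally**: there is a measurable `Ω`-valued version `Kc` of the SLE_{8/3} curve — almost
surely `γ` is a simple path from `0` to `∞` in `ℍ` and `Kc = γ(0, ∞)` — whose law under the Wiener
measure is a two-sided restriction measure of exponent `5/8`. The session-1 assembly
`sleTrace_eightThirds_isRestrictionMeasure_map` fed with its two inputs, now theorems of the tree:
SLE_{8/3} is generated by a curve (`hasSLETrace_eightThirds`, Rohde–Schramm Thm. 5.1) and the
avoidance formula of Thm. 6.1 (`sle_restriction_eightThirds_holds`).
[cite: LawlerSchrammWerner2003Restriction, Thm. 6.1 (p. 23), second sentence] -/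
theorem exists_sleTrace_eightThirds_version_isRestrictionMeasure :
    ∃ Kc : (ℝ≥0 → ℝ) → RestrictionConfig, Measurable Kc ∧
      (∀ᵐ ω ∂preWienerMeasure, IsChordalSimplePath (sleTrace ((8 : ℝ≥0) / 3) ω) ∧
        (Kc ω : Set ℂ) = sleTrace ((8 : ℝ≥0) / 3) ω '' Ioi 0) ∧
        IsRestrictionMeasure (5 / 8) (preWienerMeasure.map Kc) :=
  sleTrace_eightThirds_isRestrictionMeasure_map hasSLETrace_eightThirds sle_restriction_eightThirds_holds

/-- **`P_{5/8}` exists** — the case `α = 5/8` of the "if" half of [LSW] p. 5 result 1 ("The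
restriction measure `P_α` exists if and only if `α ≥ 5/8`"), by Thm. 6.1: the law of the SLE_{8/3}
curve is a `P_{5/8}`. Unconditional (`exists_isRestrictionMeasure_five_eighths_of_hasSLETrace` with
`hasSLETrace_eightThirds` and `sle_restriction_eightThirds_holds`).
[cite: LawlerSchrammWerner2003Restriction, p. 5 result 1 with Thm. 6.1 (p. 23)] -/
theorem exists_isRestrictionMeasure_five_eighths :
    ∃ P : Measure RestrictionConfig, IsRestrictionMeasure (5 / 8) P :=
  exists_isRestrictionMeasure_five_eighths_of_hasSLETrace hasSLETrace_eightThirds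
    sle_restriction_eightThirds_holds

/-- **There is exactly one `P_{5/8}`**: existence by Thm. 6.1 (`exists_isRestrictionMeasure_five_eighths`),
uniqueness by Prop. 3.3 / Lemma 3.2 (`IsRestrictionMeasure.unique'`).
[cite: LawlerSchrammWerner2003Restriction, Thm. 6.1 (p. 23) with Prop. 3.3 and Lemma 3.2 (pp. 10–11)] -/
theorem existsUnique_isRestrictionMeasure_five_eighths :
    ∃! P : Measure RestrictionConfig, IsRestrictionMeasure (5 / 8) P := by
  obtain ⟨P, hP⟩ := exists_isRestrictionMeasure_five_eighths
  exact ⟨P, hP, fun Q hQ ↦ hQ.unique' hP⟩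

/-- **Every `P_{5/8}` is the law of the SLE_{8/3} curve**, unconditionally (Thm. 6.1, second
sentence, with the uniqueness of Prop. 3.3): for every two-sided restriction measure `P` of
exponent `5/8` there is a measurable version `Kc` of `γ(0, ∞)`, `γ` the SLE_{8/3} trace (almost
surely a simple path from `0` to `∞` in `ℍ`), with `P = Kc_* (Wiener measure)`.
[cite: LawlerSchrammWerner2003Restriction, Thm. 6.1 (p. 23) with Prop. 3.3 (pp. 10–11)] -/
theorem IsRestrictionMeasure.exists_eq_map_sleTrace_eightThirds {P : Measure RestrictionConfig}
    (hP : IsRestrictionMeasure (5 / 8) P) :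
    ∃ Kc : (ℝ≥0 → ℝ) → RestrictionConfig, Measurable Kc ∧
      (∀ᵐ ω ∂preWienerMeasure, IsChordalSimplePath (sleTrace ((8 : ℝ≥0) / 3) ω) ∧
        (Kc ω : Set ℂ) = sleTrace ((8 : ℝ≥0) / 3) ω '' Ioi 0) ∧
        P = preWienerMeasure.map Kc :=
  hP.eq_map_sleTrace_eightThirds hasSLETrace_eightThirds sle_restriction_eightThirds_holds

/-- **`P_{5/8}` is carried by simple curves**, unconditionally ([LSW] p. 5 result 2, the `P_{5/8}`
half: "It is the law of chordal SLE_{8/3}", with Rohde–Schramm): every measurable event of `Ω`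
containing all simple-curve configurations has `P_{5/8}`-probability `1`.
[cite: LawlerSchrammWerner2003Restriction, p. 5 result 2 with Thm. 6.1 (p. 23)] -/
theorem IsRestrictionMeasure.measure_eq_one_of_isSimplePath_subset'
    {P : Measure RestrictionConfig} (hP : IsRestrictionMeasure (5 / 8) P)
    {E : Set RestrictionConfig} (hE : MeasurableSet E) (hsub : {K | K.IsSimplePath} ⊆ E) :
    P E = 1 :=
  hP.measure_eq_one_of_isSimplePath_subset hasSLETrace_eightThirds sle_restriction_eightThirds_holds
    hE hsub

/-! ### p. 5 result 1 is now Cor. 8.6 plus existence for `α > 5/8` -/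

/-- **[LSW] p. 5 result 1 ⇔ Cor. 8.6 ∧ (∀ α > 5/8, `P_α` exists).** With `P_{5/8}` in hand
(`exists_isRestrictionMeasure_five_eighths`), the named fact `exists_isRestrictionMeasure_iff` is
equivalent to the conjunction of its "only if" half, Cor. 8.6
(`not_exists_isRestrictionMeasure_of_lt_five_eighths`), and the existence statement of Thm. 7.3 for
`α > 5/8` (refining `exists_isRestrictionMeasure_iff_iff`, which asked for all `α ≥ 5/8`).
[cite: LawlerSchrammWerner2003Restriction, p. 5 result 1; Thm. 6.1 (p. 23), Thm. 7.3 (p. 29), Cor. 8.6 (p. 37)] -/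
theorem exists_isRestrictionMeasure_iff_iff_gt :
    exists_isRestrictionMeasure_iff ↔
      not_exists_isRestrictionMeasure_of_lt_five_eighths ∧
        ∀ α : ℝ, 5 / 8 < α → ∃ P : Measure RestrictionConfig, IsRestrictionMeasure α P := by
  rw [exists_isRestrictionMeasure_iff_iff]
  refine and_congr_right fun _ ↦ ⟨fun h α hα ↦ h α hα.le, fun h α hα ↦ ?_⟩
  rcases hα.eq_or_lt with rfl | hlt
  · exact exists_isRestrictionMeasure_five_eighths
  · exact h α hlt

/-- **p. 5 result 1 from Cor. 8.6 and existence for `α > 5/8`** (the two statements the paper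
proves in §8 and §7; `α = 5/8` is supplied here by Thm. 6.1).
[cite: LawlerSchrammWerner2003Restriction, p. 5 result 1; Thm. 7.3 (p. 29), Cor. 8.6 (p. 37)] -/
theorem exists_isRestrictionMeasure_iff_of_cor86_of_gt
    (h86 : not_exists_isRestrictionMeasure_of_lt_five_eighths)
    (hgt : ∀ α : ℝ, 5 / 8 < α → ∃ P : Measure RestrictionConfig, IsRestrictionMeasure α P) :
    exists_isRestrictionMeasure_iff :=
  exists_isRestrictionMeasure_iff_iff_gt.2 ⟨h86, hgt⟩

/-- **p. 5 result 1 from Cor. 8.6 and the existential form of Thm. 7.3**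
(`exists_isRestrictionMeasure_ae_interior_nonempty`: for `α > 5/8` some `P_α` exists and is carried
by configurations with interior points), the `α = 5/8` case being a theorem
(`exists_isRestrictionMeasure_iff_of_hasSLETrace` with its SLE_{8/3} inputs discharged).
[cite: LawlerSchrammWerner2003Restriction, p. 5 result 1; Thm. 7.3 (p. 29), Cor. 8.6 (p. 37)] -/
theorem exists_isRestrictionMeasure_iff_of_cor86_of_thm73
    (h86 : not_exists_isRestrictionMeasure_of_lt_five_eighths)
    (h73 : exists_isRestrictionMeasure_ae_interior_nonempty) : exists_isRestrictionMeasure_iff :=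
  exists_isRestrictionMeasure_iff_of_hasSLETrace hasSLETrace_eightThirds
    sle_restriction_eightThirds_holds h73 h86

/-! ### The "if" half and the whole of p. 5 result 1 from the five remaining leaves -/

/-- **`P_α` exists for every `α ≥ 5/8`, from the three remaining leaves of §7** ([LSW] Thm. 7.3
and the sentence after its proof, p. 29: "for all `α > 5/8`, the measure `P_α` exists and can be
constructed by adding bubbles with appropriate intensity to SLE_κ with `κ = 6/(2α + 1)`"; `κ = 8/3`,
no bubbles, covers `α = 5/8`): a Brownian bubble measure (`hμex`, §7.1), `Ξ(κ) ∈ Ω` almost surely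
(`hcfg`) and Theorem 6.5 (`h65`); the measurable version and the avoidance formula (7.3) of
Thm. 7.3 are then `SLEBubbles.exists_measurable_version_of_ae_mem` and
`SLEBubbles.measure_disjoint_of_thm65`, and Kingman's theorem is `SLEBubbles.exists_cloud_holds`
(`exists_isRestrictionMeasure_of_five_eighths_le_of_thm73`).
[cite: LawlerSchrammWerner2003Restriction, Thm. 7.3 (p. 29) and the sentence following its proof] -/
theorem exists_isRestrictionMeasure_of_five_eighths_le_of_three_leaves
    (hμex : exists_isBrownianBubbleMeasure) (hcfg : SLEBubbles.ae_mem_restrictionConfigs)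
    (h65 : SLEBubbles.lintegral_poissonAvoidance_eq_rpow) {α : ℝ} (hα : 5 / 8 ≤ α) :
    ∃ P : Measure RestrictionConfig, IsRestrictionMeasure α P :=
  exists_isRestrictionMeasure_of_five_eighths_le_of_thm73 hμex
    (SLEBubbles.exists_measurable_version_of_ae_mem hcfg) (SLEBubbles.measure_disjoint_of_thm65 h65) hα

/-- **[LSW] p. 5 result 1 from its five remaining leaves.** `exists_isRestrictionMeasure_iff`
(for `α > 0`, `P_α` exists iff `α ≥ 5/8`) follows from: the one-sided restriction martingale of
Lemmas 8.9–8.10 (`hM`) and the comparison sentence of p. 38 (`hlt`) — giving Cor. 8.6,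
`not_exists_isRestrictionMeasure_of_lt_five_eighths_of_two_leaves` — and a Brownian bubble measure
(`hμex`, §7.1), `Ξ(κ) ∈ Ω` a.s. (`hcfg`) and Theorem 6.5 (`h65`) — giving Thm. 7.3 and `P_α` for
all `α ≥ 5/8`. Everything else in the printed proofs (Prop. 3.3, Thm. 6.1 with Rohde–Schramm,
Lemmas 6.2/6.3/8.3, §8.3, Thm. 8.4 from the martingale, "`1/2` by symmetry", Kingman's theorem,
the measurability halves of Thm. 7.3) is a theorem of the tree. The discharge
`exists_isRestrictionMeasure_iff_holds` is this theorem applied to the five `_holds` theorems,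
once they exist.
[cite: LawlerSchrammWerner2003Restriction, p. 5 result 1; Thm. 7.3 (p. 29), Thm. 8.4 (p. 37), Cor. 8.6 (pp. 37–38)] -/
theorem exists_isRestrictionMeasure_iff_of_five_leaves
    (hM : SLEKappaRho.exists_isOneSidedMartingale)
    (hlt : SLEKappaRho.measure_I_notMem_fill_lt_of_neg)
    (hμex : exists_isBrownianBubbleMeasure) (hcfg : SLEBubbles.ae_mem_restrictionConfigs)
    (h65 : SLEBubbles.lintegral_poissonAvoidance_eq_rpow) : exists_isRestrictionMeasure_iff :=
  exists_isRestrictionMeasure_iff_of_leaves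
    (not_exists_isRestrictionMeasure_of_lt_five_eighths_of_two_leaves hM hlt)
    fun _ hα ↦ exists_isRestrictionMeasure_of_five_eighths_le_of_three_leaves hμex hcfg h65 hα

/-- **The same from the five leaves of `LawlerSchrammWerner2003_of_five_leaves`** (the bubble
measure taken with interior points, `exists_isBrownianBubbleMeasure_ae_interior_nonempty`, as
p. 5 result 2 needs it): so results 1 and 2 of [LSW] p. 5 close from the same five discharges.
[cite: LawlerSchrammWerner2003Restriction, p. 5 result 1; Thm. 7.3 (p. 29), Thm. 8.4 (p. 37), Cor. 8.6 (pp. 37–38)] -/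
theorem exists_isRestrictionMeasure_iff_of_five_leaves'
    (hM : SLEKappaRho.exists_isOneSidedMartingale)
    (hlt : SLEKappaRho.measure_I_notMem_fill_lt_of_neg)
    (hμex : exists_isBrownianBubbleMeasure_ae_interior_nonempty)
    (hcfg : SLEBubbles.ae_mem_restrictionConfigs)
    (h65 : SLEBubbles.lintegral_poissonAvoidance_eq_rpow) : exists_isRestrictionMeasure_iff :=
  exists_isRestrictionMeasure_iff_of_cor86_of_thm73
    (not_exists_isRestrictionMeasure_of_lt_five_eighths_of_two_leaves hM hlt)
    (exists_isRestrictionMeasure_ae_interior_nonempty_of_three_leaves hμex hcfg h65)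

end Literature.Probability.RandomPlanarGeometry

end
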